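import Summits.CriticalPhenomena.PercolationContinuityZ3.Theorems.PercNearOneGluingNoHeavyLowerTailBlockLonelyRelay
import HarnessLib

/-!
# `NoHeavyLowerTail` (stmt-CriticalPhenomena-4575), one-cut line — the SUNFLOWER BOUND for the captured relay set

For `μ = prodBernoulli w` on `Fin n`, observer `o`, relay set `A`, write `S = C(o) ∩ A` for the captured relay set.
A SUNFLOWER of candidate values is a family `{K ∪ P : P ∈ 𝓟}` with a core `K ⊆ A` and pairwise disjoint nonempty
petals `P ⊆ A ∖ K`.  Then

  `Σ_{P ∈ 𝓟} P(S = K ∪ P) ≤ max_{P ∈ 𝓟} P(P ↮ A ∖ (K ∪ P))`   (`sunflower_sum_le`, with a common bound `t`)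

— no factor `|𝓟|`.  Proof: `{S = K ∪ P} ⊆ {C(o) ∩ (A∖K) = P}`, and the antichain bound `disjointClusters_sum_le`
(Kozma–Nitzan Lemma 2 with general blocks, this directory) on the relay set `A ∖ K`.  With `K = ∅` this is the
antichain bound itself, with singleton petals and `K = ∅` the lonely relay lemma, with `K = {x}` and singleton petals
the "star of pairs" bound `Σ_a P(S = {x,a}) ≤ t`.  Together with the trivial common-core/common-gap bound
`Σ_{S ∋ x, S ∌ y} P(S = ·) ≤ P(x ↮ y)` these are the entropy-free estimates available for the lower tail of `|S|`
(ONE-CUT-STRUCTURE.md, prim-cplus-engine).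
-/

namespace Summit.CriticalPhenomena.PercolationContinuityZ3.Theorems

open scoped BigOperators Classical
open MeasureTheory Set
open Literature.Probability.LatticeModels (prodBernoulli)
open Literature.Probability.Percolation

variable {n : ℕ}

/-- **Sunflower bound.**  For a core `K ⊆ A`, pairwise disjoint nonempty petals `P ⊆ A ∖ K` (`P ∈ 𝓟`), and `t ≥ 0`
with `μ(P ↮ (A∖K)∖P) ≤ t` for every petal: `Σ_{P∈𝓟} μ(C(o) ∩ A = K ∪ P) ≤ t`.
[cite: KozmaNitzan2024, Lemma 2 (p. 6) — corollary] -/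
theorem sunflower_sum_le (w : Sym2 (Fin n) → unitInterval) (A K : Finset (Fin n)) (o : Fin n)
    (𝓟 : Finset (Finset (Fin n))) (hK : K ⊆ A) (hsub : ∀ P ∈ 𝓟, P ⊆ A \ K) (hne : ∀ P ∈ 𝓟, P.Nonempty)
    (hdisj : ∀ P' ∈ 𝓟, ∀ P'' ∈ 𝓟, P' ≠ P'' → Disjoint P' P'') (t : ℝ) (ht : 0 ≤ t)
    (hq : ∀ P ∈ 𝓟, (prodBernoulli w).real {ω | ∀ b ∈ P, ∀ a ∈ (A \ K) \ P, ω ∉ openConn b a} ≤ t) :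
    ∑ P ∈ 𝓟, (prodBernoulli w).real
        {ω : BondConfig (Fin n) | ∀ a ∈ A, ω ∈ openConn o a ↔ a ∈ K ∪ P} ≤ t := by
  have _ := hK
  refine le_trans (Finset.sum_le_sum fun P hP => measureReal_mono ?_)
    (disjointClusters_sum_le w (A \ K) o 𝓟 hsub hne hdisj t ht hq)
  intro ω hω
  simp only [mem_setOf_eq] at hω ⊢
  intro a ha
  obtain ⟨haA, haK⟩ := Finset.mem_sdiff.1 ha
  rw [hω a haA, Finset.mem_union]
  exact ⟨fun h => h.resolve_left haK, fun h => Or.inr h⟩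

/-- **Star of pairs.**  For `x ∈ A` with `|A| ≥ 3` and pairwise disconnection probabilities `≤ t` among distinct
relays: `Σ_{a ∈ A∖x} μ(C(o) ∩ A = {x, a}) ≤ t` (sunflower with core `{x}` and singleton petals).
[cite: KozmaNitzan2024, Lemma 2 (p. 6) — corollary] -/
theorem starOfPairs_sum_le (w : Sym2 (Fin n) → unitInterval) (A : Finset (Fin n)) (o x : Fin n)
    (hx : x ∈ A) (hA : 3 ≤ A.card) (t : ℝ) (ht : 0 ≤ t)
    (hpair : ∀ a ∈ A, ∀ a' ∈ A, a ≠ a' → (prodBernoulli w).real (openConn a a')ᶜ ≤ t) :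
    ∑ a ∈ A.erase x, (prodBernoulli w).real
        {ω : BondConfig (Fin n) | ∀ b ∈ A, ω ∈ openConn o b ↔ b ∈ ({x, a} : Finset (Fin n))} ≤ t := by
  have hEq : A.erase x = A \ {x} := by
    ext a; simp [Finset.mem_erase, Finset.mem_sdiff, and_comm]
  -- petals = singletons of `A \ {x}`
  have key := sunflower_sum_le w A {x} o ((A \ {x}).image fun a => ({a} : Finset (Fin n)))
    (Finset.singleton_subset_iff.2 hx)
    (fun P hP => by
      obtain ⟨a, ha, rfl⟩ := Finset.mem_image.1 hP
      exact Finset.singleton_subset_iff.2 ha)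
    (fun P hP => by
      obtain ⟨a, _, rfl⟩ := Finset.mem_image.1 hP
      exact Finset.singleton_nonempty a)
    (fun P' hP' P'' hP'' hne => by
      obtain ⟨a, _, rfl⟩ := Finset.mem_image.1 hP'
      obtain ⟨a', _, rfl⟩ := Finset.mem_image.1 hP''
      exact Finset.disjoint_singleton.2 fun h => hne (by rw [h]))
    t ht
    (fun P hP => by
      obtain ⟨a, ha, rfl⟩ := Finset.mem_image.1 hP
      obtain ⟨haA, hax⟩ := Finset.mem_sdiff.1 ha
      have hax' : a ≠ x := fun h => hax (Finset.mem_singleton.2 h)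
      -- some third relay `y ∉ {x, a}` exists since `|A| ≥ 3`
      have hcard : 1 ≤ ((A \ {x}) \ {a}).card := by
        have h1 : ((A \ {x}) \ {a}).card = (A \ {x}).card - 1 := by
          rw [Finset.card_sdiff_of_subset (Finset.singleton_subset_iff.2 ha)]; simp
        have h2 : (A \ {x}).card = A.card - 1 := by
          rw [Finset.card_sdiff_of_subset (Finset.singleton_subset_iff.2 hx)]; simp
        omega
      obtain ⟨y, hy⟩ := Finset.card_pos.1 hcard
      obtain ⟨hy1, hya⟩ := Finset.mem_sdiff.1 hy
      obtain ⟨hyA, _⟩ := Finset.mem_sdiff.1 hy1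
      have hya' : y ≠ a := fun h => hya (Finset.mem_singleton.2 h)
      calc (prodBernoulli w).real {ω | ∀ b ∈ ({a} : Finset (Fin n)), ∀ c ∈ (A \ {x}) \ {a}, ω ∉ openConn b c}
          ≤ (prodBernoulli w).real (openConn a y)ᶜ :=
            measureReal_mono fun ω hω => hω a (Finset.mem_singleton_self a) y hy
        _ ≤ t := hpair a haA y hyA (Ne.symm hya'))
  rw [Finset.sum_image (fun a ha a' ha' h => Finset.singleton_injective h)] at key
  rw [hEq]
  refine le_trans (le_of_eq (Finset.sum_congr rfl fun a _ => ?_)) key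
  rfl

end Summit.CriticalPhenomena.PercolationContinuityZ3.Theorems
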